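import Summits.BirchSwinnertonDyer.BirchSwinnertonDyer.Theorems.AlignedTransportAtTwoMainConjectureOfRankZeroBSDAtTwoFineRoadTwoTorsionCoefficients
import Summits.BirchSwinnertonDyer.BirchSwinnertonDyer.Theorems.AlignedTransportAtTwoMainConjectureOfRankZeroBSDAtTwoFineRoadPerfectDescent
import Summits.BirchSwinnertonDyer.Rank1Residual.X5.KatoOrdTwoTowerGapIff
import Literature.NumberTheory.EllipticCurves.IwasawaModuleFinitePadicIntProofs
import Literature.NumberTheory.EllipticCurves.IwasawaSelmerModuleFiniteProofs
import HarnessLib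

/-!
# Route `AlignedTransportAtTwo`, crux C2 `MainConjectureOfRankZeroBSDAtTwo` (stmt-BirchSwinnertonDyer-22298), line `birth`:
# the open stub T in 2-DESCENT CURRENCY — `μ₂(X(E/ℚ_∞)) = 0 ∧ X torsion` IS «`Sel_{2^∞}(E/ℚ_∞)[2]` is finite»,
# and (PERFECT DESCENT (v) on the SELMER side) IS «the induced `E[2]`-Selmer set over `ℚ_∞` is finite», which embeds
# faithfully over the sextic tower `ℚ_∞(E[2])` (PART XVI of the att-p3 dictionary; route-independent half)

HONEST FRAMING (cell `bsd-f1-sign2`, WIDTH-5 attach seat `bsd-line-att-p3` g7, lineage att-p3 = PERFECT DESCENT kernel,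
parts I–XV; `--supports stmt-BirchSwinnertonDyer-22298 --as helper`; BSD is NOT proved by any of this; the crux C2 stays
OPEN — six lead generations: «blocked-on `Rank1Residual.GreenbergMuConjectureIrreducible`», C2 ⟺ stub T mod PRINT, p583329).
THEOREMS ONLY — no definition, no named fact, no `sorry`; C2-NEUTRAL (closes nothing). This module imports NO route file
(the crux-level corollaries, which need the lead's `…Seed` file, are the sibling `…SeedTwoTorsionCrux`).

## What is proved

§1 (ANY number field `K`, ANY prime `p`, ANY `ℤ_p`-extension `κ` with a topological generator `γ`, ANY elliptic `W/K`,
EVERY Pontryagin-dual datum `D : W.SelmerDualData κ γ`) — the SELMER twin of the tree's FINE-Selmer statement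
`Literature…IwasawaModuleFinitePadicInt.exists_fineSelmerDualData_moduleFinite_iff_finite_pTorsion` (statement (A)):

* `finite_quotient_augIdealP_of_finite_pTorsion`: `Sel_{p^∞}(E/K_∞)[p]` finite ⟹ `X/(p)X` finite
  (the tree's axiomatic-dual lemma `IwasawaDual.finite_quotient_pSmul_of_finite_pTorsion` for the datum `D`);
* `isTorsion_and_mu_eq_zero_of_finite_pTorsion`: ⟹ `X` is `Λ`-torsion with `μ(X) = 0` (and finitely generated over `ℤ_p`,
  `moduleFinite_padicInt_of_finite_pTorsion`);
* `finite_pTorsion_of_moduleFinite_padicInt` (port of the fine proof: evaluation at `ℤ_p`-generators embeds `Sel[p]` into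
  `(ℚ/ℤ[p])ⁿ`, characters separate points) and `finite_pTorsion_of_isTorsion_of_mu_eq_zero` (Washington §13.2:
  torsion ∧ `μ = 0` ⟹ f.g. over `ℤ_p`);
* **`finite_pTorsion_iff_isTorsion_and_mu_eq_zero`: `{s ∈ Sel_{p^∞}(E/K_∞) | p·s = 0}` finite ⟺ `X` torsion ∧ `μ(X) = 0`**,
  and the `D`-free form `finite_pTorsion_iff_forall` (⟺ for EVERY topological generator `γ` and EVERY datum).

§2 (`K = ℚ`, `p = 2`): `towerGapAtTwo_iff_finite_selmer_twoTorsion` — the typed per-curve certificate `X5.O1.TowerGapAtTwo W`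
(cell `bsd-2adic`; ⟺ torsion ∧ `μ₂ = 0`, `X5.O1.towerGapAtTwo_iff_isTorsion_and_mu_eq_zero`) ⟺ «`Sel_{2^∞}(W/ℚ_∞^κ)[2]` finite for
every cyclotomic datum»: the certificate currency and the 2-descent currency are the same statement.

(The crux-level reading — modulo PRINT, C2 ⟺ «for every seed-cell curve and every cyclotomic datum `Sel_{2^∞}(W/ℚ_∞)[2]` is
finite», both directions — is the sibling module `…SeedTwoTorsionCrux`, which needs the route file through the lead's `…Seed`.)

§3 (PERFECT DESCENT (v) + (ii) on the SELMER side; `K = ℚ`, `p = 2`, `κ` cyclotomic, no rational point of order `2`):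
`finite_selmer_twoTorsion_iff_finite_twoCoeffSelmer` — with `ι_* : H¹(ℚ_∞, E[2]) ≅ H¹(ℚ_∞, E[2^∞])[2]` (att-p5 g4 p607278:
`coeffMap_injective_rat_two`, `range_coeffMap_rat_two`), `Sel_{2^∞}(W/ℚ_∞)[2]` finite ⟺ the INDUCED `E[2]`-SELMER SET
`{y ∈ H¹(ℚ_∞, E[2]) | ι_* y ∈ Sel_{2^∞}(W/ℚ_∞)}` is finite; `finite_twoCoeffSelmer_iff_finite_image_res` — by att-p3 g4's perfect
descent (part II, `PerfectDescent.resOfLe_inf_ker_galoisRepTorsion_two_injective`: `H¹(ℚ_∞, E[2]) ↪ H¹(Gal(ℚ̄/ℚ_∞(E[2])), E[2])`,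
image = the `Gal(ℚ_∞(E[2])/ℚ_∞)`-invariant classes, part V) ⟺ its faithful image over the sextic tower `F_∞ = ℚ_∞(E[2])` is finite
— there `Gal(ℚ̄/F_∞)` acts trivially on `E[2]`, so these classes ARE continuous homomorphisms `Gal(ℚ̄/F_∞) → E[2]` (the lead's
observation O1, CENSUS-lead-g4: «T ⟺ the `St`-multiplicity of `𝒳_ord(F_n)/2` is bounded»; the module half of that count is
att-p3 parts VI–XV). What is NOT done here: descending the LOCAL conditions of the induced structure place by place to `F_∞`
(the Kummer condition above `2` needs `H¹(G_w, E(F_{∞,w}))[2]`-control, not only coefficients `E[2]`; the fine/relaxed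
structures, where the condition is «restriction = 0», were descended by att-p5 g5 p610071/p611651).

References: R. Greenberg, LNM 1716 (1999) §1 p. 60 (`X/𝔪X` finite ⟺ f.g.; Conj. 1.11), Thm. 4.1; L. Washington, *Cyclotomic
Fields* §13.2 (`μ = 0` ⟺ f.g. over `ℤ_p`); M. F. Lim, R. Sujatha, §3 (fine twin); K. Kato, Astérisque 295 Thm. 17.4.
-/

set_option linter.dupNamespace false
set_option autoImplicit false

noncomputable section

open scoped Classical

namespace Summit.BirchSwinnertonDyer.BirchSwinnertonDyer.Theorems.AlignedTransportAtTwoSeedTwoTorsion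

open WeierstrassCurve Literature.NumberTheory.EllipticCurves Literature.NumberTheory.EllipticCurves.IwasawaAlgebra
  Literature.NumberTheory.EllipticCurves.IwasawaModuleFinitePadicInt Literature.NumberTheory.GaloisRepresentations

universe u

/-! ## §1 Any `K`, `p`, `κ`: `Sel_{p^∞}(E/K_∞)[p]` finite ⟺ `X(E/K_∞)` torsion with `μ = 0` -/

section General

variable {K : Type u} [Field K] [NumberField K] (W : WeierstrassCurve K) [W.IsElliptic] {p : ℕ} [hp : Fact p.Prime]
  (κ : ZpExtension K p)

omit [W.IsElliptic] in
/-- Every class of `Sel_{p^∞}(E/K_∞)` is killed by a power of `p` (it is a class of `H¹(K_∞, E[p^∞])`,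
`exists_pow_smul_subgroupH1_ker_eq_zero`). [cite: GreenbergLNM1716, §1 p. 60 (after Conj. 1.3)] -/
theorem exists_pow_smul_selmerInfty_eq_zero (s : W.selmerInfty κ) : ∃ k : ℕ, p ^ k • s = 0 := by
  obtain ⟨k, hk⟩ := W.exists_pow_smul_subgroupH1_ker_eq_zero κ (s : W.subgroupH1 p κ.kerSubgroup)
  exact ⟨k, Subtype.ext (by rw [AddSubgroupClass.coe_nsmul]; exact hk)⟩

variable {γ : Field.absoluteGaloisGroup K}

omit [W.IsElliptic] in
/-- **`Sel_{p^∞}(E/K_∞)[p]` finite ⟹ `X/(p)X` finite** for every Pontryagin-dual datum `D` of the Selmer group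
(`IwasawaDual.finite_quotient_pSmul_of_finite_pTorsion` with `D.bijective`, `D.toDual_C_smul`; `(p) = augIdealP p`).
[cite: GreenbergLNM1716, §1 p. 60 (after Conj. 1.3)] -/
theorem finite_quotient_augIdealP_of_finite_pTorsion (D : W.SelmerDualData κ γ)
    (hfin : Set.Finite {s : W.selmerInfty κ | p • s = 0}) :
    Finite (D.X ⧸ (augIdealP p • (⊤ : Submodule (IwasawaAlgebra p) D.X))) :=
  IwasawaDual.finite_quotient_pSmul_of_finite_pTorsion D.bijective D.toDual_C_smul
    (exists_pow_smul_selmerInfty_eq_zero W κ) hfin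

/-- **`Sel_{p^∞}(E/K_∞)[p]` finite ⟹ `X(E/K_∞)` is `Λ`-torsion with `μ = 0`** (for `γ` a topological generator, so that
`X` is finitely generated over `Λ`, `module_finite_holds`; then §1–§2 of `IwasawaModuleFinitePadicIntProofs`).
[cite: GreenbergLNM1716, §1 p. 60 (after Conj. 1.3)] [cite: Washington1997, §13.2] -/
theorem isTorsion_and_mu_eq_zero_of_finite_pTorsion (hγ : κ.IsTopGenerator γ) (D : W.SelmerDualData κ γ)
    (hfin : Set.Finite {s : W.selmerInfty κ | p • s = 0}) : D.IsTorsion ∧ D.mu = 0 := by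
  haveI : Module.Finite (IwasawaAlgebra p) D.X := D.module_finite_holds hγ
  have hq := finite_quotient_augIdealP_of_finite_pTorsion W κ D hfin
  have hT : Module.IsTorsion (IwasawaAlgebra p) D.X := isTorsion_of_finite_quotient_augIdealP p D.X hq
  exact ⟨hT, muInvariant_eq_zero_of_finite_quotient_augIdealP p D.X hT hq⟩

/-- `Sel_{p^∞}(E/K_∞)[p]` finite ⟹ `X(E/K_∞)` is finitely generated over `ℤ_p`. [cite: Washington1997, §13.2]
[cite: GreenbergLNM1716, §1 p. 60 (after Conj. 1.3)] -/
theorem moduleFinite_padicInt_of_finite_pTorsion (hγ : κ.IsTopGenerator γ) (D : W.SelmerDualData κ γ)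
    (hfin : Set.Finite {s : W.selmerInfty κ | p • s = 0}) :
    Module.Finite ℤ_[p] (RestrictScalars ℤ_[p] (IwasawaAlgebra p) D.X) := by
  haveI : Module.Finite (IwasawaAlgebra p) D.X := D.module_finite_holds hγ
  exact moduleFinite_padicInt_of_finite_quotient_augIdealP p D.X
    (finite_quotient_augIdealP_of_finite_pTorsion W κ D hfin)

omit [W.IsElliptic] in
/-- **`X(E/K_∞)` finitely generated over `ℤ_p` ⟹ `Sel_{p^∞}(E/K_∞)[p]` finite**: with `ℤ_p`-generators `x₁, …, xₙ`
of `X`, `s ↦ (xᵢ(s))ᵢ` embeds `Sel[p]` into the finite `(ℚ/ℤ[p])ⁿ` — a character killing `s − s'` on all generators kills it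
identically (`toDual_C_smul`), and characters separate points. (The tree's fine-Selmer proof
`finite_pTorsion_of_fineSelmerDualData_moduleFinite`, run for the Selmer datum.)
[cite: GreenbergLNM1716, §1 p. 60 (after Conj. 1.3)] [cite: LimSujatha2018, §3 (before Prop. 3.2)] -/
theorem finite_pTorsion_of_moduleFinite_padicInt (D : W.SelmerDualData κ γ)
    (hD : Module.Finite ℤ_[p] (RestrictScalars ℤ_[p] (IwasawaAlgebra p) D.X)) :
    Set.Finite {s : W.selmerInfty κ | p • s = 0} := by
  obtain ⟨G, hG⟩ := hD
  have hT : {u : AddCircle (1 : ℚ) | p • u = 0}.Finite := AddCircle.finite_torsion (1 : ℚ) hp.out.pos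
  haveI : Finite {u : AddCircle (1 : ℚ) | p • u = 0} := hT.to_subtype
  let ev : {s : W.selmerInfty κ | p • s = 0} →
      ({x : RestrictScalars ℤ_[p] (IwasawaAlgebra p) D.X // x ∈ G} → {u : AddCircle (1 : ℚ) | p • u = 0}) :=
    fun s x ↦ ⟨D.toDual (show D.X from (x.1 : RestrictScalars ℤ_[p] (IwasawaAlgebra p) D.X)) s.1, by
      change p • D.toDual _ (s.1 : W.selmerInfty κ) = 0
      rw [← map_nsmul, s.2, map_zero]⟩
  refine Set.finite_coe_iff.mp (Finite.of_injective ev fun s s' hss' ↦ ?_)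
  have hgen : ∀ x : RestrictScalars ℤ_[p] (IwasawaAlgebra p) D.X,
      D.toDual (show D.X from x) (s.1 : W.selmerInfty κ) =
        D.toDual (show D.X from x) (s'.1 : W.selmerInfty κ) := by
    intro x
    have hx : x ∈ Submodule.span ℤ_[p] (G : Set (RestrictScalars ℤ_[p] (IwasawaAlgebra p) D.X)) := by
      rw [hG]; exact Submodule.mem_top
    refine Submodule.span_induction (M := RestrictScalars ℤ_[p] (IwasawaAlgebra p) D.X)
      (p := fun y _ ↦ D.toDual (show D.X from y) (s.1 : W.selmerInfty κ) =
        D.toDual (show D.X from y) (s'.1 : W.selmerInfty κ)) ?_ ?_ ?_ ?_ hx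
    · intro y hy
      have := congrArg (fun f ↦ ((f ⟨y, Finset.mem_coe.mp hy⟩ : {u : AddCircle (1 : ℚ) | p • u = 0}) :
        AddCircle (1 : ℚ))) hss'
      exact this
    · change D.toDual 0 _ = D.toDual 0 _
      rw [map_zero, AddMonoidHom.zero_apply, AddMonoidHom.zero_apply]
    · intro y z _ _ hy hz
      change D.toDual ((show D.X from y) + (show D.X from z)) _ =
        D.toDual ((show D.X from y) + (show D.X from z)) _
      rw [map_add, AddMonoidHom.add_apply, AddMonoidHom.add_apply, hy, hz]
    · intro c y _ hy
      have e : c • y = (show RestrictScalars ℤ_[p] (IwasawaAlgebra p) D.X from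
          PowerSeries.C c • (show D.X from y)) := by
        rw [RestrictScalars.smul_def, ← PowerSeries.C_eq_algebraMap]; rfl
      rw [e]
      change D.toDual (PowerSeries.C c • (show D.X from y)) _ =
        D.toDual (PowerSeries.C c • (show D.X from y)) _
      have h1 : p ^ 1 • (s.1 : W.selmerInfty κ) = 0 := by rw [pow_one]; exact s.2
      have h2 : p ^ 1 • (s'.1 : W.selmerInfty κ) = 0 := by rw [pow_one]; exact s'.2
      rw [D.toDual_C_smul c _ _ 1 h1, D.toDual_C_smul c _ _ 1 h2, hy]
  apply Subtype.ext
  by_contra hne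
  have hne' : (s.1 : W.selmerInfty κ) - s'.1 ≠ 0 := sub_ne_zero.mpr hne
  obtain ⟨χ, hχ⟩ := CharacterModule.exists_character_apply_ne_zero_of_ne_zero hne'
  obtain ⟨x, hx⟩ := D.bijective.2 χ
  apply hχ
  have : χ ((s.1 : W.selmerInfty κ) - s'.1) = 0 := by
    rw [← hx, map_sub]
    exact sub_eq_zero.mpr (hgen x)
  exact this

/-- **`X(E/K_∞)` `Λ`-torsion with `μ = 0` ⟹ `Sel_{p^∞}(E/K_∞)[p]` finite** (`γ` a topological generator):
Washington §13.2 (`μ = 0` ⟺ f.g. over `ℤ_p`, tree `muInvariant_eq_zero_iff_holds`) + the evaluation embedding.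
[cite: Washington1997, §13.2] [cite: GreenbergLNM1716, §1 p. 60 (after Conj. 1.3)] -/
theorem finite_pTorsion_of_isTorsion_of_mu_eq_zero (hγ : κ.IsTopGenerator γ) (D : W.SelmerDualData κ γ)
    (hX : D.IsTorsion) (hμ : D.mu = 0) : Set.Finite {s : W.selmerInfty κ | p • s = 0} := by
  haveI : Module.Finite (IwasawaAlgebra p) D.X := D.module_finite_holds hγ
  exact finite_pTorsion_of_moduleFinite_padicInt W κ D ((muInvariant_eq_zero_iff_holds p D.X hX).mp hμ)

/-- **`Sel_{p^∞}(E/K_∞)[p]` finite ⟺ `X(E/K_∞)` is `Λ`-torsion with `μ = 0`** — Greenberg's «`Sel_E(F_∞)_p` is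
`Λ`-cotorsion with `μ_E = 0`» (Conj. 1.11's conclusion at a datum) in `p`-DESCENT currency: every datum `D` over a
topological generator `γ`. [cite: GreenbergLNM1716, §1 p. 60 and Conj. 1.11] [cite: Washington1997, §13.2] -/
theorem finite_pTorsion_iff_isTorsion_and_mu_eq_zero (hγ : κ.IsTopGenerator γ) (D : W.SelmerDualData κ γ) :
    Set.Finite {s : W.selmerInfty κ | p • s = 0} ↔ D.IsTorsion ∧ D.mu = 0 :=
  ⟨isTorsion_and_mu_eq_zero_of_finite_pTorsion W κ hγ D,
    fun h ↦ finite_pTorsion_of_isTorsion_of_mu_eq_zero W κ hγ D h.1 h.2⟩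

/-- The `D`-free form: given ONE topological generator `γ₀` of `Gal(K_∞/K)`, `Sel_{p^∞}(E/K_∞)[p]` is finite iff for EVERY
topological generator `γ` and EVERY dual datum `D` over it, `X` is torsion with `μ = 0` (a datum over `γ₀` exists,
`nonempty_selmerDualData_holds`). [cite: GreenbergLNM1716, §1 p. 60 and Thm. 1.3] -/
theorem finite_pTorsion_iff_forall {γ₀ : Field.absoluteGaloisGroup K} (hγ₀ : κ.IsTopGenerator γ₀) :
    Set.Finite {s : W.selmerInfty κ | p • s = 0} ↔
      ∀ (γ : Field.absoluteGaloisGroup K), κ.IsTopGenerator γ →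
        ∀ D : W.SelmerDualData κ γ, D.IsTorsion ∧ D.mu = 0 := by
  refine ⟨fun h γ hγ D ↦ isTorsion_and_mu_eq_zero_of_finite_pTorsion W κ hγ D h, fun h ↦ ?_⟩
  obtain ⟨D⟩ := W.nonempty_selmerDualData_holds κ γ₀ hγ₀
  exact (finite_pTorsion_iff_isTorsion_and_mu_eq_zero W κ hγ₀ D).mpr (h γ₀ hγ₀ D)

end General

/-! ## §2 `K = ℚ`, `p = 2`: the tower-gap certificate IS «`Sel_{2^∞}(W/ℚ_∞)[2]` finite» -/

section TowerGap

variable (W : WeierstrassCurve ℚ) [W.IsElliptic] [W.IsGloballyMinimal]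

omit [W.IsGloballyMinimal] in
/-- **`X5.O1.TowerGapAtTwo W` ⟺ for every cyclotomic `ℤ₂`-extension datum `(κ, γ)`, `Sel_{2^∞}(W/ℚ_∞^κ)[2]` is finite.**
The per-curve certificate of TURNKEY (γ) / C2′ (one gap `#(X/(2,T^{m+k})X) < 2^k·#(X/(2,T^m)X)`, cell `bsd-2adic`) and the
2-descent statement are the same thing (`X5.O1.towerGapAtTwo_iff_isTorsion_and_mu_eq_zero` + §1).
[cite: GreenbergLNM1716, §1 Conj. 1.11 and Prop. 5.14 (p. 121)] [cite: Washington1997, §13.2] -/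
theorem towerGapAtTwo_iff_finite_selmer_twoTorsion :
    Summit.BirchSwinnertonDyer.Rank1Residual.X5.O1.TowerGapAtTwo W ↔
      ∀ (κ : ZpExtension ℚ 2) (γ : Field.absoluteGaloisGroup ℚ), κ.IsCyclotomic →
        κ.IsTopGenerator γ → IsCyclotomicVariable 2 γ →
        Set.Finite {s : W.selmerInfty κ | 2 • s = 0} := by
  rw [Summit.BirchSwinnertonDyer.Rank1Residual.X5.O1.towerGapAtTwo_iff_isTorsion_and_mu_eq_zero]
  refine ⟨fun h κ γ hκ hγ hγ' ↦ ?_, fun h κ γ hκ hγ hγ' D ↦ ?_⟩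
  · obtain ⟨D⟩ := W.nonempty_selmerDualData_holds κ γ hγ
    exact (finite_pTorsion_iff_isTorsion_and_mu_eq_zero W κ hγ D).mpr (h κ γ hκ hγ hγ' D)
  · exact isTorsion_and_mu_eq_zero_of_finite_pTorsion W κ hγ D (h κ γ hκ hγ hγ')

end TowerGap

/-! ## §3 PERFECT DESCENT (v) + (ii) on the SELMER side: the induced `E[2]`-Selmer set and its image over `ℚ_∞(E[2])` -/

section TwoCoeff

open Literature.NumberTheory.EllipticCurves.Greenberg1999
  Summit.BirchSwinnertonDyer.BirchSwinnertonDyer.Theorems.AlignedTransportAtTwoFineRoad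

variable (W : WeierstrassCurve ℚ) [W.IsElliptic] (κ : ZpExtension ℚ 2)

/-- **`Sel_{2^∞}(W/ℚ_∞)[2]` finite ⟺ the INDUCED `E[2]`-SELMER SET `{y ∈ H¹(ℚ_∞, E[2]) | ι_* y ∈ Sel_{2^∞}(W/ℚ_∞)}` is finite**
(`κ` cyclotomic, no rational point of order `2`): `ι_* : H¹(ℚ_∞, E[2]) → H¹(ℚ_∞, E[2^∞])` is injective
(`TorsionCoefficients.coeffMap_injective_rat_two`, from `E(ℚ_∞)[2^∞] = 0`) with image exactly the `2`-torsion classes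
(`TorsionCoefficients.range_coeffMap_rat_two`), so it restricts to a bijection between the two sets. PERFECT-DESCENT §3 (v)
for the full Selmer group. [cite: GreenbergLNM1716, §5 p. 114 (proof of Prop. 5.8)] -/
theorem finite_selmer_twoTorsion_iff_finite_twoCoeffSelmer (hκ : κ.IsCyclotomic)
    (ht : ∀ x : ℚ, ¬ HasRationalTwoTorsionX W x) :
    Set.Finite {s : W.selmerInfty κ | 2 • s = 0} ↔
      Set.Finite {y : subgroupH1 κ.kerSubgroup (geomTorsion W ((2 : ℕ) : ℤ)) |
        resH1Hom (ContinuousMonoidHom.id κ.kerSubgroup)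
          (AddSubgroup.inclusion (geomTorsion_le_geomPrimaryTorsion W 2)) (fun _ _ ↦ rfl) y ∈ W.selmerInfty κ} := by
  set ι := (resH1Hom (ContinuousMonoidHom.id κ.kerSubgroup)
      (AddSubgroup.inclusion (geomTorsion_le_geomPrimaryTorsion W 2)) (fun _ _ ↦ rfl) :
        subgroupH1 κ.kerSubgroup (geomTorsion W ((2 : ℕ) : ℤ)) →+ subgroupH1 κ.kerSubgroup (W.geomPrimaryTorsion 2))
    with hι
  have hinj : Function.Injective ι := TorsionCoefficients.coeffMap_injective_rat_two W κ hκ ht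
  have hrange : Set.range ι = {x | 2 • x = 0} := TorsionCoefficients.range_coeffMap_rat_two W κ
  constructor
  · intro hA
    -- `y ↦ ⟨ι y, _⟩` maps the induced set injectively into `Sel[2]`
    have himg : (ι '' {y | ι y ∈ W.selmerInfty κ}).Finite := by
      refine (hA.image (fun s : W.selmerInfty κ ↦ (s : W.subgroupH1 2 κ.kerSubgroup))).subset ?_
      rintro _ ⟨y, hy, rfl⟩
      refine ⟨⟨ι y, hy⟩, ?_, rfl⟩
      change (2 • (⟨ι y, hy⟩ : W.selmerInfty κ)) = 0
      exact Subtype.ext (by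
        rw [AddSubmonoidClass.coe_nsmul, ZeroMemClass.coe_zero]
        exact TorsionCoefficients.nsmul_coeffMap_eq_zero W 2 _ y)
    exact Set.Finite.of_finite_image himg hinj.injOn
  · intro hB
    -- every `s ∈ Sel[2]` is `ι y` for a unique `y` in the induced set
    have hsub : ((fun s : W.selmerInfty κ ↦ (s : W.subgroupH1 2 κ.kerSubgroup)) '' {s | 2 • s = 0}) ⊆
        ι '' {y | ι y ∈ W.selmerInfty κ} := by
      rintro _ ⟨s, hs, rfl⟩
      have h2 : 2 • (s : W.subgroupH1 2 κ.kerSubgroup) = 0 := by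
        have := congrArg (fun z : W.selmerInfty κ ↦ (z : W.subgroupH1 2 κ.kerSubgroup)) hs
        simpa only [AddSubmonoidClass.coe_nsmul, ZeroMemClass.coe_zero] using this
      have hmem : (s : W.subgroupH1 2 κ.kerSubgroup) ∈ Set.range ι := by rw [hrange]; exact h2
      obtain ⟨y, hy⟩ := hmem
      exact ⟨y, by change ι y ∈ W.selmerInfty κ; rw [hy]; exact s.2, hy⟩
    have himg : ((fun s : W.selmerInfty κ ↦ (s : W.subgroupH1 2 κ.kerSubgroup)) '' {s | 2 • s = 0}).Finite :=
      (hB.image ι).subset hsub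
    exact Set.Finite.of_finite_image himg Subtype.coe_injective.injOn

/-- **… ⟺ its FAITHFUL IMAGE OVER THE SEXTIC TOWER `F_∞ = ℚ_∞(E[2])` is finite**: restriction
`res : H¹(Gal(ℚ̄/ℚ_∞), E[2]) → H¹(Gal(ℚ̄/ℚ_∞(E[2])), E[2])` is INJECTIVE (att-p3 g4 perfect descent, part II:
`PerfectDescent.resOfLe_inf_ker_galoisRepTorsion_two_injective` — `H¹(Q̄, V₄) = 0` for every `Q̄ ≤ Aut(V₄) ≅ S₃`), and its
image is the set of `Gal(ℚ_∞(E[2])/ℚ_∞)`-invariant classes (part V, `mem_range_resOfLe_kerSubgroup_geomTorsion_two_iff`), where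
`Gal(ℚ̄/ℚ_∞(E[2]))` acts trivially on `E[2]` so classes are continuous homomorphisms. Hence T at `(W, κ)` ⟺ finiteness of a set
of equivariant homomorphisms `Gal(ℚ̄/ℚ_∞(W[2])) → W[2]` (the lead's O1 reading; the descent of the LOCAL conditions to `F_∞` is
not done here). [cite: SerreGaloisCohomology1997, I §2.6 (b)] [cite: GreenbergLNM1716, §3 (restriction maps in the cyclotomic tower)] -/
theorem finite_twoCoeffSelmer_iff_finite_image_res :
    Set.Finite {y : subgroupH1 κ.kerSubgroup (geomTorsion W ((2 : ℕ) : ℤ)) |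
        resH1Hom (ContinuousMonoidHom.id κ.kerSubgroup)
          (AddSubgroup.inclusion (geomTorsion_le_geomPrimaryTorsion W 2)) (fun _ _ ↦ rfl) y ∈ W.selmerInfty κ} ↔
      Set.Finite (resOfLe (W.geomTorsion 2)
          (inf_le_left : κ.kerSubgroup ⊓ (W.galoisRepTorsion 2).ker ≤ κ.kerSubgroup) ''
        {y : subgroupH1 κ.kerSubgroup (geomTorsion W ((2 : ℕ) : ℤ)) |
          resH1Hom (ContinuousMonoidHom.id κ.kerSubgroup)
            (AddSubgroup.inclusion (geomTorsion_le_geomPrimaryTorsion W 2)) (fun _ _ ↦ rfl) y ∈ W.selmerInfty κ}) := by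
  have hinj := PerfectDescent.resOfLe_kerSubgroup_inf_ker_galoisRepTorsion_two_injective W (κ := κ)
  exact ⟨fun h ↦ h.image _, fun h ↦ Set.Finite.of_finite_image h hinj.injOn⟩

/-- **T at `(W, κ)` in perfect-descent form** (`κ` cyclotomic with a topological generator `γ`, no rational point of order `2`):
`X(W/ℚ_∞)` is `Λ`-torsion with `μ₂ = 0` for the datum `D` ⟺ the image over `ℚ_∞(W[2])` of the induced `E[2]`-Selmer set is
finite. (§1 + §4.) [cite: GreenbergLNM1716, §1 Conj. 1.11 and §5 p. 114] -/
theorem isTorsion_and_mu_eq_zero_iff_finite_image_res (hκ : κ.IsCyclotomic) {γ : Field.absoluteGaloisGroup ℚ}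
    (hγ : κ.IsTopGenerator γ) (ht : ∀ x : ℚ, ¬ HasRationalTwoTorsionX W x) (D : W.SelmerDualData κ γ) :
    (D.IsTorsion ∧ D.mu = 0) ↔
      Set.Finite (resOfLe (W.geomTorsion 2)
          (inf_le_left : κ.kerSubgroup ⊓ (W.galoisRepTorsion 2).ker ≤ κ.kerSubgroup) ''
        {y : subgroupH1 κ.kerSubgroup (geomTorsion W ((2 : ℕ) : ℤ)) |
          resH1Hom (ContinuousMonoidHom.id κ.kerSubgroup)
            (AddSubgroup.inclusion (geomTorsion_le_geomPrimaryTorsion W 2)) (fun _ _ ↦ rfl) y ∈ W.selmerInfty κ}) := by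
  rw [← finite_pTorsion_iff_isTorsion_and_mu_eq_zero W κ hγ D,
    finite_selmer_twoTorsion_iff_finite_twoCoeffSelmer W κ hκ ht, finite_twoCoeffSelmer_iff_finite_image_res]

end TwoCoeff

end Summit.BirchSwinnertonDyer.BirchSwinnertonDyer.Theorems.AlignedTransportAtTwoSeedTwoTorsion

end
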